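import Literature.NumberTheory.Automorphic.MeyerRatDivisibility
import Literature.NumberTheory.Automorphic.MeyerRatFiniteInvariants
import Literature.NumberTheory.Automorphic.MeyerThetaMellinCoeff
import Literature.NumberTheory.Automorphic.MeyerGcdDirichlet
import HarnessLib

/-!
# Meyer's global difference representation — proofs, `K = ℚ`: Mellin transforms of summation
# vectors, II (averaging over `Ẑˣ` and the divisibility by `ζ`)

Topic `NumberTheory/Automorphic`; namespace `Literature.NumberTheory.Automorphic.Meyer`. Sibling
PROOF file for the plan for `Meyer.spectralRealisation_rat` [Meyer2005, Thm. 5.11]: second half of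
the DIVISIBILITY theorem. For `F ∈ 𝒮(𝔸_ℚ)` with `Σ F` unramified we average `F` over a finite set
of representatives of `Ẑˣ / U` (`U` a common level of the finite parts of a tensor decomposition
of `F`): this does not change `Σ F`, and turns `F` into a finite sum of pure tensors `g ⊗ φ` with
`Ẑˣ`-INVARIANT Schwartz–Bruhat `φ` [Meyer2005, §5.2: the unramified part `V^S` is the range of the
projection `Q_S`, §5.2 before Thm. 5.1]. Then `MeyerRatFiniteInvariants`, `MeyerRatDivisibility`,
`MeyerThetaMellinCoeff` and `MeyerGcdDirichlet` compute the Mellin transform of each `Σ(g ⊗ φ)`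
as `ζ(z) · N₁^{z} P(z) M(g^{sym})(z)`:

* **`exists_mellin_meyerSum_eq_zeta_mul`** — for `F ∈ 𝒮(𝔸_ℚ)` with `Σ F` unramified there is `Q`
  holomorphic on `Re z > 0` with `∫₀^∞ ΣF[z(t)] t^{z-1} dt = ζ(z) Q(z)` for `Re z > 1` — the
  `GL₁(ℚ)`-shadow of Meyer's `Σ = ∏_p (1 - λ_p^{-1})^{-1}` on unramified vectors [Meyer2005,
  Lemma 5.3].

Everything is proved; the definitions are the averaging operators.

## References

* R. Meyer, *On a representation of the idele class group related to primes and zeros of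
  L-functions*, Duke Math. J. 127 (2005) = arXiv:math/0311468, §5.2, Lemma 5.3 [Meyer2005].
-/

noncomputable section

open MeasureTheory Set Filter Complex NumberField IsDedekindDomain NumberField.mixedEmbedding
open scoped Topology NNReal Classical

namespace Literature.NumberTheory.Automorphic.Meyer

/-! ### Representatives of `Ẑˣ / (U ∩ Ẑˣ)` and averaging -/

section Averaging

variable (U : OpenSubgroup (FiniteAdeleRing (𝓞 ℚ) ℚ)ˣ)

/-- The finite quotient `Ẑˣ / (U ∩ Ẑˣ)`. [cite: Meyer2005, §5.1] -/
abbrev unitQuot : Type :=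
  integralFiniteUnits ℚ ⧸ (U : Subgroup (FiniteAdeleRing (𝓞 ℚ) ℚ)ˣ).comap (integralFiniteUnits ℚ).subtype

/-- The quotient `Ẑˣ / (U ∩ Ẑˣ)` is finite (`Ẑˣ` compact, `U` open). [cite: Meyer2005, §5.1] -/
instance : Finite (unitQuot U) := finite_quotient_comap_of_isOpen U

/-- A `Fintype` structure on the finite quotient. [folklore] -/
noncomputable instance : Fintype (unitQuot U) := Fintype.ofFinite _

/-- A representative `û_q ∈ Ẑˣ` of the class `q`. [folklore] -/
def rep (q : unitQuot U) : (FiniteAdeleRing (𝓞 ℚ) ℚ)ˣ :=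
  ((Quotient.out q : integralFiniteUnits ℚ) : (FiniteAdeleRing (𝓞 ℚ) ℚ)ˣ)

/-- Representatives lie in `Ẑˣ`. [folklore] -/
theorem rep_mem (q : unitQuot U) : rep U q ∈ integralFiniteUnits ℚ :=
  (Quotient.out q : integralFiniteUnits ℚ).2

/-- **Averaging over `Ẑˣ / (U ∩ Ẑˣ)` on the finite adeles**: `φ^avg(x) = |Q|⁻¹ ∑_q φ(x û_q)`.
[cite: Meyer2005, §5.2] -/
def finAvg (φ : FiniteAdeleRing (𝓞 ℚ) ℚ → ℂ) (x : FiniteAdeleRing (𝓞 ℚ) ℚ) : ℂ :=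
  ((Fintype.card (unitQuot U) : ℂ))⁻¹ * ∑ q : unitQuot U, φ (x * (rep U q : FiniteAdeleRing (𝓞 ℚ) ℚ))

/-- **Averaging on the adeles**: `F^avg(y) = |Q|⁻¹ ∑_q F(y · (1, û_q))`. [cite: Meyer2005, §5.2] -/
def adeleAvg (F : AdeleRing (𝓞 ℚ) ℚ → ℂ) (y : AdeleRing (𝓞 ℚ) ℚ) : ℂ :=
  ((Fintype.card (unitQuot U) : ℂ))⁻¹ * ∑ q : unitQuot U, F (y * (finIdele ℚ (rep U q) : AdeleRing (𝓞 ℚ) ℚ))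

/-- The number of classes is non-zero. [folklore] -/
theorem card_unitQuot_ne_zero : (Fintype.card (unitQuot U) : ℂ) ≠ 0 := by
  exact_mod_cast Fintype.card_ne_zero

variable {U}

/-- **The average is `Ẑˣ`-invariant** when `φ` is `U`-invariant: the classes `q ↦ [w] q` are
permuted. [cite: Meyer2005, §5.2] -/
theorem finAvg_unit_mul {φ : FiniteAdeleRing (𝓞 ℚ) ℚ → ℂ}
    (hφU : ∀ u ∈ U, ∀ x, φ ((u : FiniteAdeleRing (𝓞 ℚ) ℚ) * x) = φ x) :
    ∀ w ∈ integralFiniteUnits ℚ, ∀ x, finAvg U φ ((w : FiniteAdeleRing (𝓞 ℚ) ℚ) * x) = finAvg U φ x := by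
  intro w hw x
  rw [finAvg, finAvg]
  congr 1
  set wbar : unitQuot U := QuotientGroup.mk (⟨w, hw⟩ : integralFiniteUnits ℚ) with hwbar
  -- `û_{[w] q} = w û_q n` with `n ∈ U`
  have hrep : ∀ q : unitQuot U, φ (x * (rep U (wbar * q) : FiniteAdeleRing (𝓞 ℚ) ℚ)) =
      φ ((w : FiniteAdeleRing (𝓞 ℚ) ℚ) * x * (rep U q : FiniteAdeleRing (𝓞 ℚ) ℚ)) := by
    intro q
    have hq : wbar * q = QuotientGroup.mk ((⟨w, hw⟩ : integralFiniteUnits ℚ) * Quotient.out q) := by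
      rw [hwbar, QuotientGroup.mk_mul, QuotientGroup.out_eq']
    obtain ⟨n, hn⟩ := QuotientGroup.mk_out_eq_mul
      (s := (U : Subgroup (FiniteAdeleRing (𝓞 ℚ) ℚ)ˣ).comap (integralFiniteUnits ℚ).subtype)
      ((⟨w, hw⟩ : integralFiniteUnits ℚ) * Quotient.out q)
    have hnU : ((n : integralFiniteUnits ℚ) : (FiniteAdeleRing (𝓞 ℚ) ℚ)ˣ) ∈ U := by
      have := n.2
      rw [Subgroup.mem_comap] at this
      exact this
    have hval : (rep U (wbar * q) : FiniteAdeleRing (𝓞 ℚ) ℚ) =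
        (w : FiniteAdeleRing (𝓞 ℚ) ℚ) * (rep U q : FiniteAdeleRing (𝓞 ℚ) ℚ) *
          (((n : integralFiniteUnits ℚ) : (FiniteAdeleRing (𝓞 ℚ) ℚ)ˣ) : FiniteAdeleRing (𝓞 ℚ) ℚ) := by
      rw [rep, hq, hn]
      rfl
    rw [hval, show x * ((w : FiniteAdeleRing (𝓞 ℚ) ℚ) * (rep U q : FiniteAdeleRing (𝓞 ℚ) ℚ) *
        (((n : integralFiniteUnits ℚ) : (FiniteAdeleRing (𝓞 ℚ) ℚ)ˣ) : FiniteAdeleRing (𝓞 ℚ) ℚ)) =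
        (((n : integralFiniteUnits ℚ) : (FiniteAdeleRing (𝓞 ℚ) ℚ)ˣ) : FiniteAdeleRing (𝓞 ℚ) ℚ) *
          ((w : FiniteAdeleRing (𝓞 ℚ) ℚ) * x * (rep U q : FiniteAdeleRing (𝓞 ℚ) ℚ)) by ring,
      hφU _ hnU]
  calc ∑ q : unitQuot U, φ ((w : FiniteAdeleRing (𝓞 ℚ) ℚ) * x * (rep U q : FiniteAdeleRing (𝓞 ℚ) ℚ))
      = ∑ q : unitQuot U, φ (x * (rep U (wbar * q) : FiniteAdeleRing (𝓞 ℚ) ℚ)) :=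
        Finset.sum_congr rfl fun q _ => (hrep q).symm
    _ = ∑ q : unitQuot U, φ (x * (rep U q : FiniteAdeleRing (𝓞 ℚ) ℚ)) :=
        Fintype.sum_equiv (Equiv.mulLeft wbar) _ _ fun q => rfl

/-- Right multiplication by a unit, as a homeomorphism of the finite adeles. [folklore] -/
def mulUnitHomeomorph (v : (FiniteAdeleRing (𝓞 ℚ) ℚ)ˣ) : FiniteAdeleRing (𝓞 ℚ) ℚ ≃ₜ FiniteAdeleRing (𝓞 ℚ) ℚ where
  toFun x := x * (v : FiniteAdeleRing (𝓞 ℚ) ℚ)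
  invFun x := x * ((v⁻¹ : (FiniteAdeleRing (𝓞 ℚ) ℚ)ˣ) : FiniteAdeleRing (𝓞 ℚ) ℚ)
  left_inv x := by simp [mul_assoc]
  right_inv x := by simp [mul_assoc]
  continuous_toFun := continuous_id.mul continuous_const
  continuous_invFun := continuous_id.mul continuous_const

/-- Translates of Schwartz–Bruhat functions by units are Schwartz–Bruhat. [folklore] -/
theorem comp_mul_unit_mem_schwartzBruhat {φ : FiniteAdeleRing (𝓞 ℚ) ℚ → ℂ}
    (hφ : φ ∈ SchwartzBruhat (FiniteAdeleRing (𝓞 ℚ) ℚ)) (v : (FiniteAdeleRing (𝓞 ℚ) ℚ)ˣ) :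
    (fun x => φ (x * (v : FiniteAdeleRing (𝓞 ℚ) ℚ))) ∈ SchwartzBruhat (FiniteAdeleRing (𝓞 ℚ) ℚ) := by
  obtain ⟨hlc, hcs⟩ := (mem_schwartzBruhat_iff).1 hφ
  have heq : (fun x => φ (x * (v : FiniteAdeleRing (𝓞 ℚ) ℚ))) = φ ∘ mulUnitHomeomorph v := rfl
  rw [heq]
  exact (mem_schwartzBruhat_iff).2 ⟨hlc.comp_continuous (mulUnitHomeomorph v).continuous,
    hcs.comp_homeomorph (mulUnitHomeomorph v)⟩

/-- **The average of a Schwartz–Bruhat function is Schwartz–Bruhat.** [cite: Meyer2005, §5.2] -/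
theorem finAvg_mem_schwartzBruhat {φ : FiniteAdeleRing (𝓞 ℚ) ℚ → ℂ}
    (hφ : φ ∈ SchwartzBruhat (FiniteAdeleRing (𝓞 ℚ) ℚ)) : finAvg U φ ∈ SchwartzBruhat (FiniteAdeleRing (𝓞 ℚ) ℚ) := by
  have hsum : (fun x => ∑ q : unitQuot U, φ (x * (rep U q : FiniteAdeleRing (𝓞 ℚ) ℚ))) ∈
      SchwartzBruhat (FiniteAdeleRing (𝓞 ℚ) ℚ) := by
    have : (fun x => ∑ q : unitQuot U, φ (x * (rep U q : FiniteAdeleRing (𝓞 ℚ) ℚ))) =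
        ∑ q : unitQuot U, fun x => φ (x * (rep U q : FiniteAdeleRing (𝓞 ℚ) ℚ)) := by
      funext x; simp [Finset.sum_apply]
    rw [this]
    exact Submodule.sum_mem _ fun q _ => comp_mul_unit_mem_schwartzBruhat hφ (rep U q)
  have heq : finAvg U φ = ((Fintype.card (unitQuot U) : ℂ))⁻¹ •
      fun x => ∑ q : unitQuot U, φ (x * (rep U q : FiniteAdeleRing (𝓞 ℚ) ℚ)) := by
    funext x; rfl
  rw [heq]
  exact Submodule.smul_mem _ _ hsum

/-- Averaging a pure tensor averages its finite part. [folklore] -/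
theorem adeleAvg_ratTensor₂ (g : ℝ → ℂ) (φ : FiniteAdeleRing (𝓞 ℚ) ℚ → ℂ) :
    adeleAvg U (ratTensor₂ g φ) = ratTensor₂ g (finAvg U φ) := by
  funext y
  rw [adeleAvg, ratTensor₂_apply, finAvg, Finset.mul_sum, Finset.mul_sum, Finset.mul_sum]
  refine Finset.sum_congr rfl fun q _ => ?_
  rw [mul_finIdele_eq, ratTensor₂_apply]
  ring

/-- Averaging is linear: finite linear combinations. [folklore] -/
theorem adeleAvg_sum {ι : Type*} (T : Finset ι) (c : ι → ℂ) (F : ι → AdeleRing (𝓞 ℚ) ℚ → ℂ) :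
    adeleAvg U (fun y => ∑ i ∈ T, c i * F i y) = fun y => ∑ i ∈ T, c i * adeleAvg U (F i) y := by
  funext y
  simp only [adeleAvg, Finset.mul_sum]
  rw [Finset.sum_comm]
  refine Finset.sum_congr rfl fun i _ => ?_
  refine Finset.sum_congr rfl fun q _ => ?_
  ring

/-- Finite sums of Bruhat–Schwartz functions have additive `Σ`. [folklore] -/
theorem meyerSum_finset_sum_of_mem {ι : Type*} (T : Finset ι) {F : ι → AdeleRing (𝓞 ℚ) ℚ → ℂ}
    (hF : ∀ i ∈ T, F i ∈ schwartzBruhatAdele ℚ) (c : ι → ℂ) :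
    meyerSum ℚ (fun y => ∑ i ∈ T, c i * F i y) = fun x => ∑ i ∈ T, c i * meyerSum ℚ (F i) x := by
  classical
  induction T using Finset.induction_on with
  | empty =>
      simp only [Finset.sum_empty]
      exact meyerSum_zero
  | insert a S ha ih =>
      have h1 : F a ∈ schwartzBruhatAdele ℚ := hF a (Finset.mem_insert_self a S)
      have hS : ∀ i ∈ S, F i ∈ schwartzBruhatAdele ℚ := fun i hi => hF i (Finset.mem_insert_of_mem hi)
      have h2 : (fun y => ∑ i ∈ S, c i * F i y) ∈ schwartzBruhatAdele ℚ := by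
        have : (fun y => ∑ i ∈ S, c i * F i y) = ∑ i ∈ S, c i • F i := by
          funext y; simp [Finset.sum_apply]
        rw [this]
        exact Submodule.sum_mem _ fun i hi => Submodule.smul_mem _ _ (hS i hi)
      have heq : (fun y => ∑ i ∈ insert a S, c i * F i y) = (c a • F a) + fun y => ∑ i ∈ S, c i * F i y := by
        funext y
        rw [Finset.sum_insert ha]
        rfl
      rw [heq, meyerSum_add_of_mem (Submodule.smul_mem _ _ h1) h2, meyerSum_smul, ih hS]
      funext x
      rw [Finset.sum_insert ha]
      rfl

/-- **Averaging does not change an unramified `Σ F`.** [cite: Meyer2005, §5.2] -/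
theorem meyerSum_adeleAvg {F : AdeleRing (𝓞 ℚ) ℚ → ℂ} (hF : F ∈ schwartzBruhatAdele ℚ)
    (hunr : ∀ u ∈ integralFiniteUnits ℚ, ∀ x, meyerSum ℚ F (x * finiteUnitClass ℚ u) = meyerSum ℚ F x) :
    meyerSum ℚ (adeleAvg U F) = meyerSum ℚ F := by
  have heq : adeleAvg U F = fun y => ∑ q ∈ (Finset.univ : Finset (unitQuot U)),
      ((Fintype.card (unitQuot U) : ℂ))⁻¹ * (fun y => F (y * (finIdele ℚ (rep U q) : AdeleRing (𝓞 ℚ) ℚ))) y := by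
    funext y
    rw [adeleAvg, Finset.mul_sum]
  rw [heq, meyerSum_finset_sum_of_mem _ (fun q _ => comp_mul_finIdele_mem_schwartzBruhatAdele hF (rep U q))]
  funext x
  simp_rw [meyerSum_comp_mul_finIdele, hunr _ (rep_mem U _)]
  rw [Finset.sum_const, Finset.card_univ, nsmul_eq_mul, ← mul_assoc, mul_inv_cancel₀ (card_unitQuot_ne_zero U),
    one_mul]

end Averaging

/-! ### Tensor decomposition of `𝒮(𝔸_ℚ)` -/

section Decomposition

/-- **Every `F ∈ 𝒮(𝔸_ℚ)` is a finite linear combination of pure tensors `g ⊗ φ`** with `g` Schwartz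
on `ℝ` and `φ` Schwartz–Bruhat on `𝔸_ℚ^∞`, all `φ` invariant under a common open subgroup `U(𝔫)`.
[cite: Meyer2005, §5.1] -/
theorem exists_sum_ratTensor₂ {F : AdeleRing (𝓞 ℚ) ℚ → ℂ} (hF : F ∈ schwartzBruhatAdele ℚ) :
    ∃ (ι : Type) (T : Finset ι) (c : ι → ℂ) (g : ι → SchwartzMap ℝ ℂ) (φ : ι → FiniteAdeleRing (𝓞 ℚ) ℚ → ℂ)
      (𝔫 : Ideal (𝓞 ℚ)), 𝔫 ≠ 0 ∧
      (∀ i ∈ T, φ i ∈ SchwartzBruhat (FiniteAdeleRing (𝓞 ℚ) ℚ)) ∧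
      (∀ i ∈ T, ∀ u ∈ congruenceUnits ℚ 𝔫, ∀ x, φ i ((u : FiniteAdeleRing (𝓞 ℚ) ℚ) * x) = φ i x) ∧
      F = fun y => ∑ i ∈ T, c i * ratTensor₂ (g i) (φ i) y := by
  have hF₁ := mem_schwartzBruhatAdele_iff.mp hF
  rw [piSchwartzBruhat, Submodule.mem_span_iff_exists_finset_subset] at hF₁
  obtain ⟨c, T, hTS, -, hsum⟩ := hF₁
  -- factorisations of the members of `T`
  have hfact : ∀ Ψ ∈ T, IsFactorizablePiSchwartzBruhat ℚ (Fin 1) Ψ := fun Ψ hΨ => hTS hΨ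
  choose! Φinf Φfin hfin hΨ using hfact
  -- scalar archimedean parts
  set E : ℝ ≃L[ℝ] (Fin 1 → mixedSpace ℚ) :=
    mixedSpaceEquivReal.symm.trans (ContinuousLinearEquiv.funUnique (Fin 1) ℝ (mixedSpace ℚ)).symm with hE
  set g : ((Fin 1 → AdeleRing (𝓞 ℚ) ℚ) → ℂ) → SchwartzMap ℝ ℂ :=
    fun Ψ => SchwartzMap.compCLMOfContinuousLinearEquiv ℂ E (Φinf Ψ) with hg
  set φ : ((Fin 1 → AdeleRing (𝓞 ℚ) ℚ) → ℂ) → FiniteAdeleRing (𝓞 ℚ) ℚ → ℂ :=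
    fun Ψ x => Φfin Ψ (fun _ => x) with hφ
  -- levels
  have hlev : ∀ Ψ ∈ T, ∃ 𝔫 : Ideal (𝓞 ℚ), 𝔫 ≠ 0 ∧ ∀ u ∈ congruenceUnits ℚ 𝔫, ∀ x,
      φ Ψ ((u : FiniteAdeleRing (𝓞 ℚ) ℚ) * x) = φ Ψ x := by
    intro Ψ hΨT
    obtain ⟨𝔫, h𝔫, h⟩ := exists_ideal_forall_smul_eq_of_mem_schwartzBruhat (hfin Ψ hΨT)
    refine ⟨𝔫, h𝔫, fun u hu x => ?_⟩
    have := h u hu (fun _ => x)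
    simpa only [hφ, Pi.smul_def, smul_eq_mul] using this
  choose! 𝔫 h𝔫 hlev' using hlev
  set 𝔫₀ : Ideal (𝓞 ℚ) := ∏ Ψ ∈ T, 𝔫 Ψ with h𝔫₀
  have h𝔫₀0 : 𝔫₀ ≠ 0 := by
    rw [h𝔫₀, Finset.prod_ne_zero_iff]
    exact fun Ψ hΨ => h𝔫 Ψ hΨ
  have hle : ∀ Ψ ∈ T, 𝔫₀ ≤ 𝔫 Ψ := fun Ψ hΨ =>
    (Ideal.prod_le_inf).trans (Finset.inf_le hΨ)
  refine ⟨(Fin 1 → AdeleRing (𝓞 ℚ) ℚ) → ℂ, T, c, g, φ, 𝔫₀, h𝔫₀0, fun Ψ hΨ => ?_, fun Ψ hΨ u hu x => ?_, ?_⟩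
  · -- `φ Ψ` is Schwartz–Bruhat
    obtain ⟨hlc, hcs⟩ := (mem_schwartzBruhat_iff).1 (hfin Ψ hΨ)
    have heq : φ Ψ = Φfin Ψ ∘ (Homeomorph.funUnique (Fin 1) (FiniteAdeleRing (𝓞 ℚ) ℚ)).symm := by
      funext x; rfl
    rw [heq]
    exact (mem_schwartzBruhat_iff).2 ⟨hlc.comp_continuous (Homeomorph.continuous _), hcs.comp_homeomorph _⟩
  · exact hlev' Ψ hΨ u (congruenceUnits_mono h𝔫₀0 (hle Ψ hΨ) hu) x
  · funext y
    have h := congrFun hsum (fun _ => y)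
    simp only [Finset.sum_apply, Pi.smul_apply, smul_eq_mul] at h
    rw [← h]
    refine Finset.sum_congr rfl fun Ψ hΨT => ?_
    congr 1
    have h1 : Ψ (fun _ => y) = Φinf Ψ (piArch ℚ (Fin 1) fun _ => y) * Φfin Ψ (piFinite ℚ (Fin 1) fun _ => y) := by
      conv_lhs => rw [hΨ Ψ hΨT]
    rw [h1, ratTensor₂_apply]
    have harch : (g Ψ) (mixedSpaceEquivReal (InfiniteAdeleRing.ringEquiv_mixedSpace ℚ y.1)) =
        Φinf Ψ (piArch ℚ (Fin 1) fun _ => y) := by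
      simp only [hg, SchwartzMap.compCLMOfContinuousLinearEquiv_apply, Function.comp_apply, hE,
        ContinuousLinearEquiv.trans_apply, ContinuousLinearEquiv.symm_apply_apply]
      congr 1
    have hfinp : φ Ψ y.2 = Φfin Ψ (piFinite ℚ (Fin 1) fun _ => y) := by
      simp only [hφ]
      congr 1
    rw [harch, hfinp]

end Decomposition

/-! ### Mellin transforms of the pure tensors and of `Σ F` -/

section Assembly

/-- `mellin` only sees `t > 0`. [folklore] -/
theorem mellin_congr_Ioi {f g : ℝ → ℂ} (h : ∀ t : ℝ, 0 < t → f t = g t) (z : ℂ) : mellin f z = mellin g z := by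
  rw [mellin, mellin]
  exact setIntegral_congr_fun measurableSet_Ioi fun t ht => by rw [h t ht]

/-- `mellin` of a finite linear combination of Mellin-convergent functions. [folklore] -/
theorem mellin_finset_sum {ι : Type*} (T : Finset ι) (c : ι → ℂ) {f : ι → ℝ → ℂ} {z : ℂ}
    (hf : ∀ i ∈ T, MellinConvergent (f i) z) :
    mellin (fun t => ∑ i ∈ T, c i * f i t) z = ∑ i ∈ T, c i * mellin (f i) z := by
  rw [mellin]
  have hint : ∀ i ∈ T, Integrable (fun t : ℝ => (t : ℂ) ^ (z - 1) • (c i * f i t)) (volume.restrict (Ioi 0)) := by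
    intro i hi
    have := (hf i hi).const_mul (c i)
    refine this.congr (Eventually.of_forall fun t => ?_)
    simp only [smul_eq_mul]; ring
  have h1 : (∫ t in Ioi (0 : ℝ), (t : ℂ) ^ (z - 1) • ∑ i ∈ T, c i * f i t) =
      ∫ t in Ioi (0 : ℝ), ∑ i ∈ T, (t : ℂ) ^ (z - 1) • (c i * f i t) := by
    refine setIntegral_congr_fun measurableSet_Ioi fun t _ => ?_
    rw [Finset.smul_sum]
  rw [h1, integral_finsetSum _ hint]
  refine Finset.sum_congr rfl fun i _ => ?_
  rw [mellin, ← integral_const_mul]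
  refine setIntegral_congr_fun measurableSet_Ioi fun t _ => ?_
  simp only [smul_eq_mul]; ring

/-- The symmetrisation `g(t) + g(-t)` as a Schwartz function. [folklore] -/
def symSchwartz (g : SchwartzMap ℝ ℂ) : SchwartzMap ℝ ℂ :=
  g + SchwartzMap.compCLMOfContinuousLinearEquiv ℂ (ContinuousLinearEquiv.neg ℝ) g

/-- Values of the symmetrisation. [folklore] -/
@[simp]
theorem symSchwartz_apply (g : SchwartzMap ℝ ℂ) (t : ℝ) : symSchwartz g t = g t + g (-t) := by
  simp [symSchwartz, SchwartzMap.compCLMOfContinuousLinearEquiv_apply]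

/-- Dilation `t ↦ G(c t)` of a Schwartz function by `c ≠ 0`, as a Schwartz function. [folklore] -/
def dilSchwartz (c : ℝ) (hc : c ≠ 0) (G : SchwartzMap ℝ ℂ) : SchwartzMap ℝ ℂ :=
  SchwartzMap.compCLMOfContinuousLinearEquiv ℂ (ContinuousLinearEquiv.unitsEquivAut ℝ (Units.mk0 c hc)) G

/-- Values of the dilation. [folklore] -/
@[simp]
theorem dilSchwartz_apply (c : ℝ) (hc : c ≠ 0) (G : SchwartzMap ℝ ℂ) (t : ℝ) : dilSchwartz c hc G t = G (c * t) := by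
  rw [dilSchwartz, SchwartzMap.compCLMOfContinuousLinearEquiv_apply, Function.comp_apply,
    ContinuousLinearEquiv.unitsEquivAut_apply, Units.val_mk0, mul_comm]

/-- The Mellin transform of a Schwartz function is holomorphic on `Re z > 0`. [folklore] -/
theorem differentiableAt_mellin_schwartz (G : SchwartzMap ℝ ℂ) {z : ℂ} (hz : 0 < z.re) :
    DifferentiableAt ℂ (mellin (fun t : ℝ => G t)) z :=
  mellin_differentiableAt_of_isBigO_rpow (G.continuous.locallyIntegrable.locallyIntegrableOn _)
    (schwartz_isBigO_atTop_rpow_neg G (z.re + 1)) (by linarith) (schwartz_isBigO_nhdsGT_zero G) (by simpa using hz)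

/-- **The Mellin transform of `Σ(g ⊗ φ)` for `Ẑˣ`-invariant `φ`**: `ζ(z)` times an explicit function
holomorphic on `Re z > 0`. [cite: Meyer2005, Lemma 5.3] -/
theorem exists_mellin_meyerSum_ratTensor₂ (g : SchwartzMap ℝ ℂ) {φ : FiniteAdeleRing (𝓞 ℚ) ℚ → ℂ}
    (hφ : φ ∈ SchwartzBruhat (FiniteAdeleRing (𝓞 ℚ) ℚ))
    (hinv : ∀ u ∈ integralFiniteUnits ℚ, ∀ x, φ ((u : FiniteAdeleRing (𝓞 ℚ) ℚ) * x) = φ x) :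
    ∃ Q : ℂ → ℂ, DifferentiableOn ℂ Q {z : ℂ | 0 < z.re} ∧
      ∀ z : ℂ, 1 < z.re → mellin (fun t : ℝ => meyerSum ℚ (ratTensor₂ g φ) (posClass (Real.log t))) z =
        riemannZeta z * Q z := by
  obtain ⟨N₁, M, hN₁, hM, hsupp, a, ha, hval⟩ := exists_gcd_seq_of_invariant hφ hinv
  -- the coefficient sequence `b(n) = a(gcd(n, M))`, bounded and gcd-class
  set b : ℕ → ℂ := fun n => a (Nat.gcd n M) with hb
  have hbgcd : ∀ n, n ≠ 0 → b n = b (Nat.gcd n M) := by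
    intro n _
    simp only [hb, Nat.gcd_gcd_self_left_right]
  set B : ℝ := ∑ d ∈ M.divisors, ‖a d‖ with hB
  have hbB : ∀ n, ‖b n‖ ≤ B := by
    intro n
    rcases eq_or_ne n 0 with rfl | hn
    · simp only [hb, Nat.gcd_zero_left]
      exact Finset.single_le_sum (f := fun d => ‖a d‖) (fun _ _ => norm_nonneg _)
        (Nat.mem_divisors.mpr ⟨dvd_rfl, hM⟩)
    · exact Finset.single_le_sum (f := fun d => ‖a d‖) (fun _ _ => norm_nonneg _)
        (Nat.mem_divisors.mpr ⟨Nat.gcd_dvd_right n M, hM⟩)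
  obtain ⟨cf, hcf, hL⟩ := exists_LSeries_eq_dirichletPolynomial_mul_zeta hM hbgcd
  set G : SchwartzMap ℝ ℂ := symSchwartz g with hG
  set cN : ℝ := (N₁ : ℝ)⁻¹ with hcN
  have hcNpos : 0 < cN := by rw [hcN]; positivity
  refine ⟨fun z => (cN : ℂ) ^ (-z) * (∑ d ∈ M.divisors, cf d * (d : ℂ) ^ (-z)) * mellin (fun t : ℝ => G t) z,
    ?_, fun z hz => ?_⟩
  · intro z hz
    refine DifferentiableAt.differentiableWithinAt ?_
    refine ((DifferentiableAt.mul ?_ ((differentiable_dirichletPolynomial M cf) z)).mul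
      (differentiableAt_mellin_schwartz G hz))
    exact (differentiableAt_id.neg.const_cpow (Or.inl (by exact_mod_cast hcNpos.ne')))
  · -- pointwise: `Σ(g ⊗ φ)[z(t)] = ∑_{n ≥ 1} b(n) G(n t / N₁)` for `t > 0`
    have hpt : ∀ t : ℝ, 0 < t → meyerSum ℚ (ratTensor₂ g φ) (posClass (Real.log t)) =
        ∑' n : ℕ, b (n + 1) * G (((n + 1 : ℕ) : ℝ) * (cN * t)) := by
      intro t ht
      rw [meyerSum_ratTensor₂_posClass g hN₁ hsupp hval, Real.exp_log ht]
      have h1 : Summable fun n : ℕ => g (((n + 1 : ℕ) : ℝ) * (cN * t)) * a (Nat.gcd (n + 1) M) := by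
        have := summable_coeff_schwartz_comp_nat_mul g hbB hcNpos ht
        exact this.congr fun n => by simp only [hb]; ring
      have h2 : Summable fun n : ℕ => g (-(((n + 1 : ℕ) : ℝ) * (cN * t))) * a (Nat.gcd (n + 1) M) := by
        have := summable_coeff_schwartz_comp_nat_mul
          (SchwartzMap.compCLMOfContinuousLinearEquiv ℂ (ContinuousLinearEquiv.neg ℝ) g) hbB hcNpos ht
        refine this.congr fun n => ?_
        simp only [hb, SchwartzMap.compCLMOfContinuousLinearEquiv_apply, Function.comp_apply]
        rw [mul_comm]
        rfl
      have h3 := tsum_int_gcd_eq_tsum_nat g a M (cN * t) h1 h2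
      have h4 : (fun m : ℤ => if m = 0 then (0 : ℂ) else g ((m : ℝ) / N₁ * t) * a (Int.gcd m M)) =
          fun m : ℤ => if m = 0 then (0 : ℂ) else g ((m : ℝ) * (cN * t)) * a (Int.gcd m M) := by
        funext m
        rw [hcN, div_eq_mul_inv, mul_assoc]
      rw [h4, h3]
      refine tsum_congr fun n => ?_
      simp only [hb, hG, symSchwartz_apply]
    rw [mellin_congr_Ioi hpt z, mellin_tsum_coeff G hbB hcNpos hz, hL z hz]
    ring

/-- **Schwartz form of the Mellin transform of `Σ(g ⊗ φ)`**: it is `ζ(z) Mκ(z)` (`Re z > 1`) for an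
explicit EVEN Schwartz function `κ` on `ℝ` (a finite combination of dilates of `g(t) + g(-t)`).
[cite: Meyer2005, Lemma 5.3] -/
theorem exists_schwartz_mellin_meyerSum_ratTensor₂ (g : SchwartzMap ℝ ℂ) {φ : FiniteAdeleRing (𝓞 ℚ) ℚ → ℂ}
    (hφ : φ ∈ SchwartzBruhat (FiniteAdeleRing (𝓞 ℚ) ℚ))
    (hinv : ∀ u ∈ integralFiniteUnits ℚ, ∀ x, φ ((u : FiniteAdeleRing (𝓞 ℚ) ℚ) * x) = φ x) :
    ∃ κ : SchwartzMap ℝ ℂ, (∀ t, κ (-t) = κ t) ∧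
      ∀ z : ℂ, 1 < z.re → mellin (fun t : ℝ => meyerSum ℚ (ratTensor₂ g φ) (posClass (Real.log t))) z =
        riemannZeta z * mellin (fun t : ℝ => κ t) z := by
  classical
  obtain ⟨N₁, M, hN₁, hM, hsupp, a, ha, hval⟩ := exists_gcd_seq_of_invariant hφ hinv
  set b : ℕ → ℂ := fun n => a (Nat.gcd n M) with hb
  have hbgcd : ∀ n, n ≠ 0 → b n = b (Nat.gcd n M) := by
    intro n _
    simp only [hb, Nat.gcd_gcd_self_left_right]
  set B : ℝ := ∑ d ∈ M.divisors, ‖a d‖ with hB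
  have hbB : ∀ n, ‖b n‖ ≤ B := by
    intro n
    rcases eq_or_ne n 0 with rfl | hn
    · simp only [hb, Nat.gcd_zero_left]
      exact Finset.single_le_sum (f := fun d => ‖a d‖) (fun _ _ => norm_nonneg _)
        (Nat.mem_divisors.mpr ⟨dvd_rfl, hM⟩)
    · exact Finset.single_le_sum (f := fun d => ‖a d‖) (fun _ _ => norm_nonneg _)
        (Nat.mem_divisors.mpr ⟨Nat.gcd_dvd_right n M, hM⟩)
  obtain ⟨cf, hcf, hL⟩ := exists_LSeries_eq_dirichletPolynomial_mul_zeta hM hbgcd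
  set G : SchwartzMap ℝ ℂ := symSchwartz g with hG
  set cN : ℝ := (N₁ : ℝ)⁻¹ with hcN
  have hcNpos : 0 < cN := by rw [hcN]; positivity
  -- `κ(t) = ∑_{d ∣ M} cf(d) G(d cN t)`
  set κ : SchwartzMap ℝ ℂ := ∑ d ∈ M.divisors,
    (if hd : (d : ℝ) * cN ≠ 0 then cf d • dilSchwartz ((d : ℝ) * cN) hd G else 0) with hκ
  have hdne : ∀ d ∈ M.divisors, (d : ℝ) * cN ≠ 0 := fun d hd =>
    (mul_pos (by exact_mod_cast Nat.pos_of_mem_divisors hd) hcNpos).ne'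
  have hκapply : ∀ t, κ t = ∑ d ∈ M.divisors, cf d * G ((d : ℝ) * cN * t) := by
    intro t
    rw [hκ]
    simp only [sum_apply]
    refine Finset.sum_congr rfl fun d hd => ?_
    rw [dif_pos (hdne d hd), smul_apply, dilSchwartz_apply, smul_eq_mul]
  refine ⟨κ, fun t => ?_, fun z hz => ?_⟩
  · rw [hκapply, hκapply]
    refine Finset.sum_congr rfl fun d _ => ?_
    rw [mul_neg, hG, symSchwartz_apply, symSchwartz_apply, neg_neg, add_comm]
  · -- Mellin of `κ`: `∑ cf(d) (d cN)^{-z} MG(z)`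
    have hMκ : mellin (fun t : ℝ => κ t) z = (cN : ℂ) ^ (-z) * (∑ d ∈ M.divisors, cf d * (d : ℂ) ^ (-z)) *
        mellin (fun t : ℝ => G t) z := by
      have hconv : ∀ d ∈ M.divisors, MellinConvergent (fun t : ℝ => G ((d : ℝ) * cN * t)) z := fun d hd =>
        (MellinConvergent.comp_mul_left (mul_pos (by exact_mod_cast Nat.pos_of_mem_divisors hd) hcNpos)).mpr
          (mellinConvergent_schwartz G (by linarith))
      have hfun : (fun t : ℝ => κ t) = fun t => ∑ d ∈ M.divisors, cf d * G ((d : ℝ) * cN * t) := funext hκapply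
      rw [hfun, mellin_finset_sum M.divisors cf hconv, Finset.mul_sum, Finset.sum_mul]
      refine Finset.sum_congr rfl fun d hd => ?_
      have hdpos : (0 : ℝ) < (d : ℝ) * cN := mul_pos (by exact_mod_cast Nat.pos_of_mem_divisors hd) hcNpos
      rw [mellin_comp_mul_left (fun t : ℝ => G t) z hdpos, smul_eq_mul, Complex.ofReal_mul,
        Complex.mul_cpow_ofReal_nonneg (by positivity) hcNpos.le]
      push_cast
      ring
    -- pointwise: `Σ(g ⊗ φ)[z(t)] = ∑_{n ≥ 1} b(n) G(n t / N₁)` for `t > 0`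
    have hpt : ∀ t : ℝ, 0 < t → meyerSum ℚ (ratTensor₂ g φ) (posClass (Real.log t)) =
        ∑' n : ℕ, b (n + 1) * G (((n + 1 : ℕ) : ℝ) * (cN * t)) := by
      intro t ht
      rw [meyerSum_ratTensor₂_posClass g hN₁ hsupp hval, Real.exp_log ht]
      have h1 : Summable fun n : ℕ => g (((n + 1 : ℕ) : ℝ) * (cN * t)) * a (Nat.gcd (n + 1) M) := by
        have := summable_coeff_schwartz_comp_nat_mul g hbB hcNpos ht
        exact this.congr fun n => by simp only [hb]; ring
      have h2 : Summable fun n : ℕ => g (-(((n + 1 : ℕ) : ℝ) * (cN * t))) * a (Nat.gcd (n + 1) M) := by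
        have := summable_coeff_schwartz_comp_nat_mul
          (SchwartzMap.compCLMOfContinuousLinearEquiv ℂ (ContinuousLinearEquiv.neg ℝ) g) hbB hcNpos ht
        refine this.congr fun n => ?_
        simp only [hb, SchwartzMap.compCLMOfContinuousLinearEquiv_apply, Function.comp_apply]
        rw [mul_comm]
        rfl
      have h3 := tsum_int_gcd_eq_tsum_nat g a M (cN * t) h1 h2
      have h4 : (fun m : ℤ => if m = 0 then (0 : ℂ) else g ((m : ℝ) / N₁ * t) * a (Int.gcd m M)) =
          fun m : ℤ => if m = 0 then (0 : ℂ) else g ((m : ℝ) * (cN * t)) * a (Int.gcd m M) := by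
        funext m
        rw [hcN, div_eq_mul_inv, mul_assoc]
      rw [h4, h3]
      refine tsum_congr fun n => ?_
      simp only [hb, hG, symSchwartz_apply]
    rw [mellin_congr_Ioi hpt z, mellin_tsum_coeff G hbB hcNpos hz, hL z hz, hMκ]
    ring

/-- **DIVISIBILITY BY `ζ`.** For `F ∈ 𝒮(𝔸_ℚ)` with `Σ F` unramified there is `Q` holomorphic on
`Re z > 0` with `∫₀^∞ ΣF[z(t)] t^{z-1} dt = ζ(z) Q(z)` for `Re z > 1` — Meyer's Euler factorisation
of the summation map on unramified vectors, `Σ = ∏_p (1 - λ_p^{-1})^{-1}`, read through the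
Fourier–Laplace transform. [cite: Meyer2005, Lemma 5.3] -/
theorem exists_mellin_meyerSum_eq_zeta_mul {F : AdeleRing (𝓞 ℚ) ℚ → ℂ} (hF : F ∈ schwartzBruhatAdele ℚ)
    (hunr : ∀ u ∈ integralFiniteUnits ℚ, ∀ x, meyerSum ℚ F (x * finiteUnitClass ℚ u) = meyerSum ℚ F x) :
    ∃ Q : ℂ → ℂ, DifferentiableOn ℂ Q {z : ℂ | 0 < z.re} ∧
      ∀ z : ℂ, 1 < z.re → mellin (fun t : ℝ => meyerSum ℚ F (posClass (Real.log t))) z = riemannZeta z * Q z := by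
  obtain ⟨ι, T, c, g, φ, 𝔫, h𝔫, hφ, hlev, hFeq⟩ := exists_sum_ratTensor₂ hF
  set U : OpenSubgroup (FiniteAdeleRing (𝓞 ℚ) ℚ)ˣ := congruenceUnits ℚ 𝔫 with hU
  -- the averaged finite parts are Schwartz–Bruhat and `Ẑˣ`-invariant
  have hφavg : ∀ i ∈ T, finAvg U (φ i) ∈ SchwartzBruhat (FiniteAdeleRing (𝓞 ℚ) ℚ) :=
    fun i hi => finAvg_mem_schwartzBruhat (hφ i hi)
  have hinv : ∀ i ∈ T, ∀ u ∈ integralFiniteUnits ℚ, ∀ x,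
      finAvg U (φ i) ((u : FiniteAdeleRing (𝓞 ℚ) ℚ) * x) = finAvg U (φ i) x :=
    fun i hi => finAvg_unit_mul (fun u hu x => hlev i hi u hu x)
  -- `Σ F = ∑ c_i Σ(g_i ⊗ φ_i^avg)`
  have havg : adeleAvg U F = fun y => ∑ i ∈ T, c i * ratTensor₂ (g i) (finAvg U (φ i)) y := by
    rw [hFeq, adeleAvg_sum]
    funext y
    refine Finset.sum_congr rfl fun i _ => ?_
    congr 1
    exact congrFun (adeleAvg_ratTensor₂ (U := U) (g i) (φ i)) y
  have hmem : ∀ i ∈ T, ratTensor₂ (g i) (finAvg U (φ i)) ∈ schwartzBruhatAdele ℚ :=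
    fun i hi => ratTensor₂_mem_schwartzBruhatAdele (g i) (hφavg i hi)
  have hSumEq : meyerSum ℚ F = fun x => ∑ i ∈ T, c i * meyerSum ℚ (ratTensor₂ (g i) (finAvg U (φ i))) x := by
    rw [← meyerSum_adeleAvg (U := U) hF hunr, havg, meyerSum_finset_sum_of_mem T hmem c]
  -- Mellin transforms of the pieces
  have hpieces : ∀ i ∈ T, ∃ Q : ℂ → ℂ, DifferentiableOn ℂ Q {z : ℂ | 0 < z.re} ∧
      ∀ z : ℂ, 1 < z.re →
        mellin (fun t : ℝ => meyerSum ℚ (ratTensor₂ (g i) (finAvg U (φ i))) (posClass (Real.log t))) z =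
          riemannZeta z * Q z :=
    fun i hi => exists_mellin_meyerSum_ratTensor₂ (g i) (hφavg i hi) (hinv i hi)
  choose! Q hQdiff hQ using hpieces
  refine ⟨fun z => ∑ i ∈ T, c i * Q i z, ?_, fun z hz => ?_⟩
  · exact DifferentiableOn.fun_sum fun i hi => (differentiableOn_const _).mul (hQdiff i hi)
  · have hconv : ∀ i ∈ T, MellinConvergent
        (fun t : ℝ => meyerSum ℚ (ratTensor₂ (g i) (finAvg U (φ i))) (posClass (Real.log t))) z :=
      fun i hi => mellinConvergent_meyerSum (hmem i hi) (meyerSum_ratTensor₂_unramified _ (hinv i hi)) hz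
    have hfun : (fun t : ℝ => meyerSum ℚ F (posClass (Real.log t))) =
        fun t : ℝ => ∑ i ∈ T, c i * meyerSum ℚ (ratTensor₂ (g i) (finAvg U (φ i))) (posClass (Real.log t)) := by
      funext t; rw [hSumEq]
    rw [hfun, mellin_finset_sum T c hconv, Finset.mul_sum]
    refine Finset.sum_congr rfl fun i hi => ?_
    rw [hQ i hi z hz]
    ring

/-- **DIVISIBILITY BY `ζ`, Schwartz form.** For `F ∈ 𝒮(𝔸_ℚ)` with `Σ F` unramified there is an even
Schwartz function `κ` on `ℝ` with `∫₀^∞ ΣF[z(t)] t^{z-1} dt = ζ(z) ∫₀^∞ κ(t) t^{z-1} dt` for `Re z > 1`.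
[cite: Meyer2005, Lemma 5.3] -/
theorem exists_schwartz_mellin_meyerSum {F : AdeleRing (𝓞 ℚ) ℚ → ℂ} (hF : F ∈ schwartzBruhatAdele ℚ)
    (hunr : ∀ u ∈ integralFiniteUnits ℚ, ∀ x, meyerSum ℚ F (x * finiteUnitClass ℚ u) = meyerSum ℚ F x) :
    ∃ κ : SchwartzMap ℝ ℂ, (∀ t, κ (-t) = κ t) ∧
      ∀ z : ℂ, 1 < z.re → mellin (fun t : ℝ => meyerSum ℚ F (posClass (Real.log t))) z =
        riemannZeta z * mellin (fun t : ℝ => κ t) z := by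
  classical
  obtain ⟨ι, T, c, g, φ, 𝔫, h𝔫, hφ, hlev, hFeq⟩ := exists_sum_ratTensor₂ hF
  set U : OpenSubgroup (FiniteAdeleRing (𝓞 ℚ) ℚ)ˣ := congruenceUnits ℚ 𝔫 with hU
  have hφavg : ∀ i ∈ T, finAvg U (φ i) ∈ SchwartzBruhat (FiniteAdeleRing (𝓞 ℚ) ℚ) :=
    fun i hi => finAvg_mem_schwartzBruhat (hφ i hi)
  have hinv : ∀ i ∈ T, ∀ u ∈ integralFiniteUnits ℚ, ∀ x,
      finAvg U (φ i) ((u : FiniteAdeleRing (𝓞 ℚ) ℚ) * x) = finAvg U (φ i) x :=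
    fun i hi => finAvg_unit_mul (fun u hu x => hlev i hi u hu x)
  have havg : adeleAvg U F = fun y => ∑ i ∈ T, c i * ratTensor₂ (g i) (finAvg U (φ i)) y := by
    rw [hFeq, adeleAvg_sum]
    funext y
    refine Finset.sum_congr rfl fun i _ => ?_
    congr 1
    exact congrFun (adeleAvg_ratTensor₂ (U := U) (g i) (φ i)) y
  have hmem : ∀ i ∈ T, ratTensor₂ (g i) (finAvg U (φ i)) ∈ schwartzBruhatAdele ℚ :=
    fun i hi => ratTensor₂_mem_schwartzBruhatAdele (g i) (hφavg i hi)
  have hSumEq : meyerSum ℚ F = fun x => ∑ i ∈ T, c i * meyerSum ℚ (ratTensor₂ (g i) (finAvg U (φ i))) x := by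
    rw [← meyerSum_adeleAvg (U := U) hF hunr, havg, meyerSum_finset_sum_of_mem T hmem c]
  have hpieces : ∀ i ∈ T, ∃ κ : SchwartzMap ℝ ℂ, (∀ t, κ (-t) = κ t) ∧
      ∀ z : ℂ, 1 < z.re →
        mellin (fun t : ℝ => meyerSum ℚ (ratTensor₂ (g i) (finAvg U (φ i))) (posClass (Real.log t))) z =
          riemannZeta z * mellin (fun t : ℝ => κ t) z :=
    fun i hi => exists_schwartz_mellin_meyerSum_ratTensor₂ (g i) (hφavg i hi) (hinv i hi)
  choose! κ hκeven hκ using hpieces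
  refine ⟨∑ i ∈ T, c i • κ i, fun t => ?_, fun z hz => ?_⟩
  · simp only [sum_apply, smul_apply]
    exact Finset.sum_congr rfl fun i hi => by rw [hκeven i hi]
  · have hconv : ∀ i ∈ T, MellinConvergent
        (fun t : ℝ => meyerSum ℚ (ratTensor₂ (g i) (finAvg U (φ i))) (posClass (Real.log t))) z :=
      fun i hi => mellinConvergent_meyerSum (hmem i hi) (meyerSum_ratTensor₂_unramified _ (hinv i hi)) hz
    have hfun : (fun t : ℝ => meyerSum ℚ F (posClass (Real.log t))) =
        fun t : ℝ => ∑ i ∈ T, c i * meyerSum ℚ (ratTensor₂ (g i) (finAvg U (φ i))) (posClass (Real.log t)) := by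
      funext t; rw [hSumEq]
    have hκconv : ∀ i ∈ T, MellinConvergent (fun t : ℝ => κ i t) z :=
      fun i _ => mellinConvergent_schwartz (κ i) (by linarith)
    have hκfun : (fun t : ℝ => (∑ i ∈ T, c i • κ i) t) = fun t => ∑ i ∈ T, c i * κ i t := by
      funext t; simp only [sum_apply, smul_apply, smul_eq_mul]
    rw [hfun, mellin_finset_sum T c hconv, hκfun, mellin_finset_sum T c hκconv, Finset.mul_sum]
    refine Finset.sum_congr rfl fun i hi => ?_
    rw [hκ i hi z hz]
    ring

end Assembly

end Literature.NumberTheory.Automorphic.Meyer
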